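import Literature.MathematicalPhysics.QuantumFieldTheory.Balaban1983to89.B9Thm312WholeL2
import Literature.MathematicalPhysics.QuantumFieldTheory.Balaban1983to89.B11HessianL2

/-!
# `Balaban1983to89.B9Thm312WholeFormSmallFromL2` — [B9] Theorem 3.12 (pp. 420–423): THE RELATIVE FORM BOUND OF THE
# SECT.-D LEAVES (`B9Thm312Whole.FormSmall`: |⟨f, Δ′_πf⟩|, |⟨f, (Δ′_π + Δ⁽²⁾_π)f⟩| ≦ r⟨f, Δ_af⟩) PROVED from the block-L²
# letter of the perturbation (`B9Thm312WholeL2.StepL2`), Theorem 3.3 (3.46)₀ for G₀, the symmetry of G₀, Theorem 3.11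
# for Δ_a and G₀Δ_a = I — one block Schur test ([4] Lemma 2.1) and one monotone inversion

T. Bałaban, *Propagators for lattice gauge theories in a background field*, Commun. Math. Phys. **99** (1985) 389–434
[`Balaban1985BackgroundPropagators`, "B9"]; [4] = T. Bałaban, *Propagators and renormalization transformations for lattice gauge
theories. II*, Commun. Math. Phys. **96** (1984) 223–250 [`Balaban1984PropagatorsII`].

statement-level skeleton of published theorems with citation tags; proofs where landed; nothing here is a claim about the Yang–Mills
mass gap

THE PRINTED LOCUS (held text `paper:balaban1985-cmp99-background-propagators`).  p. 420: *"It differs from the operator investigated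
in previous sections by the additional term Δ′_π, but we will prove that this term is a small perturbation of Δ_a"*; p. 423: *"This
bound implies that the operators Δ⁽²⁾, Δ⁽²⁾_π are small in a proper sense, if α₀ is sufficiently small"*; Theorem 3.12 p. 423:
*"Theorems 3.3, 3.10, 3.11 hold for the propagators G, G₁"*; Theorem 3.11 p. 416 (Δ_a, G positive definite) and ITS MECHANISM (p. 416):
*"G = G₀(I − R)⁻¹, R is an operator with small norm … ⟨A,(I − R\*)A⟩ = ⟨A,A⟩ − Re⟨A,RA⟩ ≧ (1 − O(1)M⁻¹)⟨A,A⟩ > 0"* — an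
L²-smallness of the perturbation relative to the unperturbed operator; (3.46) p. 398 (the block-L² members of Theorem 3.3, among
them ‖hG(U)λ‖ ≦ B₀(Lʲη)²·|h|e^{−δ₀d(y,y′)}‖λ‖ — in the convention of this lineage B₂·Lʲη·L^{j′}η by p. 398's remark); [4] Lemma 2.1
(2.61) p. 234 (the row sum).

THE POINT.  The Sect.-D leaves of this lineage (rows 20–21 of N06-ASSIGNMENT v1; consumed at def-Y's instance by n06-d's certificate,
binder `hrest12`) display `FormSmall 𝔬 r U` — Δ_a > 0 (`posS0`, Theorem 3.11 for Δ_a) and the RELATIVE FORM BOUNDS `small`, `small1`: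
|⟨f, Tf⟩| ≦ r⟨f, Δ_af⟩ for T = Δ′_π and T = Δ′_π + Δ⁽²⁾_π (r = O(1)·Mα₀), from which `B9Thm312WholeLeaf.posDef_of_formSmall` derives
Theorem 3.11 for G, G₁.  The same certificate ALREADY displays the block-L² letter of T (`StepL2 𝔬 R₀ H₀ θ δ₁ U`: ‖1_{Δ(y)}Tμ‖₂ ≦
θ(Lʲη)⁻¹(L^{j′}η)⁻¹e^{−δ₁d(y,y′)}‖μ‖₂ for supp μ ⊂ Δ(y′)) and DERIVES (edition 13, from rows 18's Theorem 3.10) the block-L² member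
(3.46)₀ of Theorem 3.3 for G₀ (`Thm33G0L2P.l0`: ‖1_{Δ(y)}G₀μ‖₂ ≦ B₂·Lʲη·L^{j′}η·e^{−δ₁d}‖μ‖₂).  THIS FILE proves the two relative form
bounds from exactly these, plus G₀ symmetric, Δ_a > 0 and G₀Δ_a = I:
* §1 ★ `abs_form_le_of_stepBlockBd` — THE FORM OF T BY THE BLOCK SCHUR TEST: |⟨f, Tf⟩| ≦ θ·c·Σ_y (Lʲη)⁻²‖1_{Δ(y)}f‖₂² (r1-g6's
  `B9SectDL2Decay.abs_dotProduct_le_of_blockBd` + b11's `B11HessianL2.schur_quadratic`, row sum (2.61) at a rate σ ≦ δ₁, d symmetric).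
* §2 ★ `weightedL2_le_form_of_l0` — THE WEIGHTED COERCIVITY OF Δ_a: Σ_y (Lʲη)⁻²‖1_{Δ(y)}f‖₂² ≦ B₂·c·⟨f, Δ_af⟩ — the Schur test on
  G₀'s (3.46)₀ blocks gives ⟨u, G₀u⟩ ≦ B₂c·Σ_y (Lʲη)²‖1_{Δ(y)}u‖₂², and the monotone inversion G₀ ≦ M·W⁻² ⇒ W² ≦ M·Δ_a is done in
  Cauchy–Schwarz form for the G₀-pairing (`cs_of_transposePair`; u := W²f, W = (Lʲη)⁻¹ on Δ(y); pattern of b11's `cs_of_psd` ∕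
  `gap_transfer`, ML-SUPPLIED steps B3–B4).
* §3 ★★ `formSmall_of_stepL2` — `FormSmall 𝔬 r U` for every r ≧ θ·c·(B₂·c), from `StepL2 𝔬 R₀ H₀ θ δ₁′ U`, the l0 block bound at (B₂, δ₁),
  `RowSum (toB6 g R₀ H₀) σ c` with σ ≦ min(δ₁, δ₁′), `IsTransposePair (𝔬.G0 U) (𝔬.G0 U)`, `PosDefEnd (𝔬.S0 U)`, `𝔬.G0 U * 𝔬.S0 U = 1`.
  In the certificate's numerics (θ = θ₂·Mα₀): r = (θ₂·B₂·c²)·Mα₀, print's O(1)·Mα₀.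

HONEST SCOPE.  Kernel-checked finite-dimensional bookkeeping (block Schur + Cauchy–Schwarz); the block-L² letter of Δ′_π, Δ′_π + Δ⁽²⁾_π
(`StepL2`, printed shape — its derivation from (3.120), (3.131), (3.135)–(3.137), Theorem 3.1 and (3.49) is the located gap G-B9-16 ∕
C-r1g6-1), Theorem 3.3 for G₀ and Theorem 3.11 for Δ_a stay HYPOTHESES of printed shape.  The route is p. 416's (L²-smallness of the
perturbation against the unperturbed operator), read in the energy norm of Δ_a as the leaf's `posDef_of_formSmall` wants it; r1's
`B9SectDForm` certifies the same linear algebra at matrix level (not imported: this file works at the `Module.End` level of the leaves).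
COUNT-NEUTRAL; N06 is NOT discharged; one finite lattice at a time; nothing continuum, nothing about the mass gap.  Cell `pub-ymgap`
(HUMAN RULING D-0062), Track A node N06 [B9], N06-ASSIGNMENT v1 rows 20–21 (bundle F7), seat `pub-ymgap-dag-n06-l` (g12), 2026-08-27.
-/

namespace Literature.MathematicalPhysics.QuantumFieldTheory.Balaban1983to89.B9Thm312WholeFormSmallFromL2

open Literature.MathematicalPhysics.QuantumFieldTheory.Balaban1983to89
open Finset B6RandomWalk B11SectG B9Thm34Ext B9SectDL2Decay B9Thm37Glue B9Thm312Whole B9Thm312WholeL2 B11HessianL2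

noncomputable section

variable {g : B9.Geometry} {B : B9.Backgrounds} {X Y Z W : Type}
variable [Fintype X] [Fintype Y] [Fintype Z] [Fintype W] [Fintype g.Site]
variable {R₀ : ℝ} {H₀ : Prop}

/-! ## §1 The form of a block-bounded operator: the block Schur test -/

omit [Fintype Y] [Fintype Z] [Fintype W] in
/-- The squared block size of a block-constant multiple φ(y)·f on Δ(y) is φ(y)²‖1_{Δ(y)}f‖₂². [folklore] -/
private theorem bsq_scaleMul (blk : X → g.Site) (φ : g.Site → ℝ) (y : g.Site) (f : X → ℝ) :
    bsq (g := toB6 g R₀ H₀) blk y (fun x => φ (blk x) * f x) = φ y ^ 2 * bsq (g := toB6 g R₀ H₀) blk y f := by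
  classical
  unfold bsq
  rw [Finset.mul_sum]
  refine Finset.sum_congr rfl fun x _ => ?_
  split_ifs with hx
  · subst hx
    ring
  · rw [mul_zero]

omit [Fintype Y] [Fintype Z] [Fintype W] in
/-- The block size of a block-constant multiple φ(y)·f on Δ(y) is |φ(y)|·‖1_{Δ(y)}f‖₂. [folklore] -/
private theorem bl2_scaleMul (blk : X → g.Site) (φ : g.Site → ℝ) (y : g.Site) (f : X → ℝ) :
    bl2 (g := toB6 g R₀ H₀) blk y (fun x => φ (blk x) * f x) = |φ y| * bl2 (g := toB6 g R₀ H₀) blk y f := by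
  rw [bl2, bsq_scaleMul, Real.sqrt_mul' _ (bsq_nonneg _ _ _), Real.sqrt_sq_eq_abs, bl2]

omit [Fintype Y] [Fintype Z] [Fintype W] in
/-- Σ_y (Lʲη)⁻²‖1_{Δ(y)}f‖₂² = ⟨W²f, f⟩ with the block-constant weight W = (Lʲη)⁻¹ on Δ(y), y ∈ Λ_j (the blocks partition the lattice).
[folklore] -/
private theorem sum_weight_bl2_sq_eq_dotProduct (blk : X → g.Site) (f : X → ℝ) :
    ∑ y : g.Site, ((g.len y)⁻¹ * bl2 (g := toB6 g R₀ H₀) blk y f) ^ 2 =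
      (fun x => (g.len (blk x))⁻¹ ^ 2 * f x) ⬝ᵥ f := by
  have h1 : ∀ y : g.Site, ((g.len y)⁻¹ * bl2 (g := toB6 g R₀ H₀) blk y f) ^ 2 =
      bsq (g := toB6 g R₀ H₀) blk y (fun x => (g.len (blk x))⁻¹ * f x) := fun y => by
    rw [mul_pow, bl2_sq]
    exact (bsq_scaleMul (R₀ := R₀) (H₀ := H₀) blk (fun y' => (g.len y')⁻¹) y f).symm
  calc ∑ y : g.Site, ((g.len y)⁻¹ * bl2 (g := toB6 g R₀ H₀) blk y f) ^ 2
      = ∑ y : g.Site, bsq (g := toB6 g R₀ H₀) blk y (fun x => (g.len (blk x))⁻¹ * f x) :=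
        Finset.sum_congr rfl fun y _ => h1 y
    _ = ∑ x : X, ((g.len (blk x))⁻¹ * f x) ^ 2 := sum_bsq (g := toB6 g R₀ H₀) blk (fun x => (g.len (blk x))⁻¹ * f x)
    _ = (fun x => (g.len (blk x))⁻¹ ^ 2 * f x) ⬝ᵥ f := by
        unfold dotProduct
        exact Finset.sum_congr rfl fun x _ => by ring

/-- ★ **THE FORM OF THE PERTURBATION BY THE BLOCK SCHUR TEST**: an operator T with the block-L² bound
‖1_{Δ(y)}Tμ‖₂ ≦ θ(Lʲη)⁻¹(L^{j′}η)⁻¹e^{−δ₁d(y,y′)}‖μ‖₂ (supp μ ⊂ Δ(y′); the shape of `StepL2`) satisfies, for every f,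
|⟨f, Tf⟩| ≦ θ·c·Σ_y (Lʲη)⁻²‖1_{Δ(y)}f‖₂² — f = Σ_y 1_{Δ(y)}f, Cauchy–Schwarz on each block, then the Schur test with the row sum
Σ_{y′} e^{−δ₁d(y,y′)} ≦ c of [4] Lemma 2.1 (2.61) (d symmetric, so the column sums are row sums).
[cite: Balaban1985BackgroundPropagators, Thm 3.12 p.423 + Thm 3.11 p.416 (mechanism) + (3.46) p.398; Balaban1984PropagatorsII, Lemma 2.1 (2.61) p.234 + (2.52) p.232] -/
theorem abs_form_le_of_stepBlockBd (hG : GeoOK g) {blk : X → g.Site} {T : Module.End ℝ (X → ℝ)} {θ δ₁ σ c : ℝ}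
    (hrow : RowSum (toB6 g R₀ H₀) σ c) (hσ : σ ≤ δ₁) (hθ : 0 ≤ θ)
    (hT : BlockBd (g := toB6 g R₀ H₀) blk blk T
      (fun (y y' : g.Site) => θ * (g.len y)⁻¹ * (g.len y')⁻¹ * Real.exp (-(δ₁ * g.dist y y'))))
    (f : X → ℝ) :
    |f ⬝ᵥ T f| ≤ θ * c * ∑ y : g.Site, ((g.len y)⁻¹ * bl2 (g := toB6 g R₀ H₀) blk y f) ^ 2 := by
  have h1 := abs_dotProduct_le_of_blockBd (g := toB6 g R₀ H₀) hT f f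
  have hrowδ : RowSum (toB6 g R₀ H₀) δ₁ c := hrow.mono (fun a b => hG.dnn a b) hσ
  set a : g.Site → ℝ := fun y => (g.len y)⁻¹ * bl2 (g := toB6 g R₀ H₀) blk y f with ha
  set k : g.Site → g.Site → ℝ := fun y y' => θ * Real.exp (-(δ₁ * g.dist y y')) with hk
  have hk0 : ∀ i j, 0 ≤ k i j := fun i j => mul_nonneg hθ (Real.exp_nonneg _)
  have hrowk : ∀ i, ∑ j, k i j ≤ θ * c := fun i => by
    have hi := hrowδ i
    simp only [toB6_dist] at hi
    rw [hk, ← Finset.mul_sum]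
    exact mul_le_mul_of_nonneg_left hi hθ
  have hcolk : ∀ j, ∑ i, k i j ≤ θ * c := fun j => by
    have hsy : ∑ i, k i j = ∑ i, k j i := Finset.sum_congr rfl fun i _ => by simp only [hk, hG.symm i j]
    rw [hsy]
    exact hrowk j
  have h2 := schur_quadratic k hk0 (θ * c) hrowk hcolk a
  calc |f ⬝ᵥ T f|
      ≤ ∑ y, ∑ y', θ * (g.len y)⁻¹ * (g.len y')⁻¹ * Real.exp (-(δ₁ * g.dist y y')) *
          bl2 (g := toB6 g R₀ H₀) blk y f * bl2 (g := toB6 g R₀ H₀) blk y' f := h1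
    _ = ∑ y, ∑ y', k y y' * (a y * a y') :=
        Finset.sum_congr rfl fun y _ => Finset.sum_congr rfl fun y' _ => by simp only [hk, ha]; ring
    _ ≤ θ * c * ∑ y, a y ^ 2 := h2

/-! ## §2 The weighted coercivity of Δ_a from Theorem 3.3 (3.46)₀ for G₀: Schur + monotone inversion -/

omit [Fintype Y] [Fintype Z] [Fintype W] [Fintype g.Site] in
/-- Cauchy–Schwarz for the pairing ⟨u, Gv⟩ of a symmetric operator with a non-negative form (b11's `cs_of_psd` for the dot-product
pairing): ⟨u, Gv⟩² ≦ ⟨u, Gu⟩⟨v, Gv⟩. [folklore] -/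
private theorem cs_of_transposePair {G : Module.End ℝ (X → ℝ)} (hsym : IsTransposePair G G) (hpsd : ∀ u : X → ℝ, 0 ≤ u ⬝ᵥ G u)
    (u v : X → ℝ) : (u ⬝ᵥ G v) ^ 2 ≤ (u ⬝ᵥ G u) * (v ⬝ᵥ G v) := by
  have hs : v ⬝ᵥ G u = u ⬝ᵥ G v := by
    rw [dotProduct_comm v (G u)]
    exact hsym u v
  have key : ∀ t : ℝ, 0 ≤ (v ⬝ᵥ G v) * (t * t) + (-(2 * (u ⬝ᵥ G v))) * t + u ⬝ᵥ G u := by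
    intro t
    have h := hpsd (u - t • v)
    have hexp : (u - t • v) ⬝ᵥ G (u - t • v) = u ⬝ᵥ G u - 2 * t * (u ⬝ᵥ G v) + t * t * (v ⬝ᵥ G v) := by
      simp only [map_sub, map_smul, sub_dotProduct, dotProduct_sub, smul_dotProduct, dotProduct_smul, smul_eq_mul, hs]
      ring
    rw [hexp] at h
    linarith
  have hd := discrim_le_zero key
  unfold discrim at hd
  nlinarith [hd]

/-- ★ **THE WEIGHTED COERCIVITY OF Δ_a FROM THEOREM 3.3 (3.46)₀ FOR G₀**: if G₀ is symmetric with the non-negative block-L² bound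
‖1_{Δ(y)}G₀μ‖₂ ≦ B₂·Lʲη·L^{j′}η·e^{−δ₁d(y,y′)}‖μ‖₂ (supp μ ⊂ Δ(y′)), Δ_a is positive definite and G₀Δ_a = I, then for every f
Σ_y (Lʲη)⁻²‖1_{Δ(y)}f‖₂² ≦ B₂·c·⟨f, Δ_af⟩ (c = the row sum (2.61) at a rate σ ≦ δ₁).  Proof: with u := W²f (W = (Lʲη)⁻¹ on Δ(y)) the
Schur test on G₀'s blocks gives ⟨u, G₀u⟩ ≦ B₂c·Σ_y(Lʲη)²‖1_{Δ(y)}u‖₂² = B₂c·Σ_y(Lʲη)⁻²‖1_{Δ(y)}f‖₂², and Cauchy–Schwarz in the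
G₀-pairing, ⟨u, G₀Δ_af⟩² ≦ ⟨u, G₀u⟩⟨Δ_af, G₀Δ_af⟩ with G₀Δ_af = f, is (Σ_y(Lʲη)⁻²‖1_{Δ(y)}f‖₂²)² ≦ ⟨u,G₀u⟩·⟨f,Δ_af⟩ — the monotone
inversion of p. 416's mechanism in the energy norm.
[cite: Balaban1985BackgroundPropagators, Thm 3.11 p.416 + (3.46) p.398 + (3.122) p.420; Balaban1984PropagatorsII, Lemma 2.1 (2.61) p.234] -/
theorem weightedL2_le_form_of_l0 (hG : GeoOK g) {blk : X → g.Site} {G0 S0 : Module.End ℝ (X → ℝ)} {B₂ δ₁ σ c : ℝ}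
    (hrow : RowSum (toB6 g R₀ H₀) σ c) (hc : 0 ≤ c) (hσ : σ ≤ δ₁) (hB₂ : 0 ≤ B₂)
    (hsym : IsTransposePair G0 G0) (hpos : PosDefEnd S0) (hinv : G0 * S0 = 1)
    (hl0 : BlockBd (g := toB6 g R₀ H₀) blk blk G0
      (fun (y y' : g.Site) => B₂ * g.len y * g.len y' * Real.exp (-(δ₁ * g.dist y y'))))
    (f : X → ℝ) :
    ∑ y : g.Site, ((g.len y)⁻¹ * bl2 (g := toB6 g R₀ H₀) blk y f) ^ 2 ≤ B₂ * c * (f ⬝ᵥ S0 f) := by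
  have hSG : S0 * G0 = 1 := mul_eq_one_comm.mp hinv
  -- G₀ has a non-negative form: ⟨u, G₀u⟩ = ⟨Δ_a(G₀u), G₀u⟩ ≧ 0
  have hpsd : ∀ u : X → ℝ, 0 ≤ u ⬝ᵥ G0 u := fun u => by
    have hu : S0 (G0 u) = u := by
      have := LinearMap.congr_fun hSG u
      simpa [Module.End.mul_apply] using this
    calc (0 : ℝ) ≤ G0 u ⬝ᵥ S0 (G0 u) := hpos.nonneg (G0 u)
      _ = u ⬝ᵥ G0 u := by rw [hu, dotProduct_comm]
  -- the weight and the test vector u = W²f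
  set w : X → ℝ := fun x => (g.len (blk x))⁻¹ with hw
  set u : X → ℝ := fun x => w x ^ 2 * f x with hu
  set a : ℝ := ∑ y : g.Site, ((g.len y)⁻¹ * bl2 (g := toB6 g R₀ H₀) blk y f) ^ 2 with ha_def
  have ha0 : 0 ≤ a := Finset.sum_nonneg fun y _ => sq_nonneg _
  have hau : a = u ⬝ᵥ f := by rw [ha_def, sum_weight_bl2_sq_eq_dotProduct]
  -- the block sizes of u: ‖1_{Δ(y)}u‖₂ = (Lʲη)⁻²‖1_{Δ(y)}f‖₂
  have hbu : ∀ y : g.Site, bl2 (g := toB6 g R₀ H₀) blk y u = (g.len y)⁻¹ ^ 2 * bl2 (g := toB6 g R₀ H₀) blk y f := by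
    intro y
    have h := bl2_scaleMul (R₀ := R₀) (H₀ := H₀) blk (fun y => (g.len y)⁻¹ ^ 2) y f
    rw [abs_of_nonneg (sq_nonneg _)] at h
    exact h
  -- Schur on G₀'s blocks: ⟨u, G₀u⟩ ≦ B₂c·a
  have hrowδ : RowSum (toB6 g R₀ H₀) δ₁ c := hrow.mono (fun a b => hG.dnn a b) hσ
  set k : g.Site → g.Site → ℝ := fun y y' => B₂ * Real.exp (-(δ₁ * g.dist y y')) with hk
  have hk0 : ∀ i j, 0 ≤ k i j := fun i j => mul_nonneg hB₂ (Real.exp_nonneg _)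
  have hrowk : ∀ i, ∑ j, k i j ≤ B₂ * c := fun i => by
    have hi := hrowδ i
    simp only [toB6_dist] at hi
    rw [hk, ← Finset.mul_sum]
    exact mul_le_mul_of_nonneg_left hi hB₂
  have hcolk : ∀ j, ∑ i, k i j ≤ B₂ * c := fun j => by
    have hsy : ∑ i, k i j = ∑ i, k j i := Finset.sum_congr rfl fun i _ => by simp only [hk, hG.symm i j]
    rw [hsy]
    exact hrowk j
  set A : g.Site → ℝ := fun y => g.len y * bl2 (g := toB6 g R₀ H₀) blk y u with hA
  have hAa : ∀ y, A y = (g.len y)⁻¹ * bl2 (g := toB6 g R₀ H₀) blk y f := fun y => by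
    have hy : g.len y ≠ 0 := (hG.lenpos y).ne'
    rw [hA]
    simp only [hbu y]
    field_simp
  have hschur : u ⬝ᵥ G0 u ≤ B₂ * c * a := by
    have h1 := abs_dotProduct_le_of_blockBd (g := toB6 g R₀ H₀) hl0 u u
    have h2 := schur_quadratic k hk0 (B₂ * c) hrowk hcolk A
    calc u ⬝ᵥ G0 u ≤ |u ⬝ᵥ G0 u| := le_abs_self _
      _ ≤ ∑ y, ∑ y', B₂ * g.len y * g.len y' * Real.exp (-(δ₁ * g.dist y y')) *
            bl2 (g := toB6 g R₀ H₀) blk y u * bl2 (g := toB6 g R₀ H₀) blk y' u := h1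
      _ = ∑ y, ∑ y', k y y' * (A y * A y') :=
          Finset.sum_congr rfl fun y _ => Finset.sum_congr rfl fun y' _ => by simp only [hk, hA]; ring
      _ ≤ B₂ * c * ∑ y, A y ^ 2 := h2
      _ = B₂ * c * a := by simp only [hAa, ha_def]
  -- Cauchy–Schwarz in the G₀-pairing with v = Δ_af, G₀Δ_af = f
  have hGS : G0 (S0 f) = f := by
    have := LinearMap.congr_fun hinv f
    simpa [Module.End.mul_apply] using this
  have hcs := cs_of_transposePair hsym hpsd u (S0 f)
  rw [hGS, ← hau, dotProduct_comm (S0 f) f] at hcs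
  -- a² ≦ (B₂c·a)·⟨f, Δ_af⟩ ⇒ a ≦ B₂c·⟨f, Δ_af⟩
  have hb : 0 ≤ f ⬝ᵥ S0 f := hpos.nonneg f
  have hM : 0 ≤ B₂ * c := mul_nonneg hB₂ hc
  have h3 : a ^ 2 ≤ B₂ * c * a * (f ⬝ᵥ S0 f) :=
    hcs.trans (mul_le_mul_of_nonneg_right hschur hb)
  rcases ha0.eq_or_lt with h0 | hpos'
  · rw [← h0]; exact mul_nonneg hM hb
  · have h4 : a * a ≤ a * (B₂ * c * (f ⬝ᵥ S0 f)) := by nlinarith [h3]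
    exact le_of_mul_le_mul_left h4 hpos'

/-! ## §3 The relative form bound of rows 20–21 from the L² letter, (3.46)₀ for G₀, and Theorem 3.11 for Δ_a -/

omit [Fintype Y] [Fintype Z] [Fintype W] in
/-- ★★ **`FormSmall` OF ROWS 20–21 FROM THE BLOCK-L² LETTER OF THE PERTURBATION** — |⟨f, Δ′_πf⟩| ≦ r⟨f, Δ_af⟩ and |⟨f, (Δ′_π +
Δ⁽²⁾_π)f⟩| ≦ r⟨f, Δ_af⟩ for every r ≧ θ·c·(B₂·c), from: the block-L² letter `StepL2 𝔬 R₀ H₀ θ δ₁′ U` of Δ′_π and Δ′_π + Δ⁽²⁾_π (displayed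
by the certificate already), Theorem 3.3 (3.46)₀ for G₀ as the block bound B₂·Lʲη·L^{j′}η·e^{−δ₁d} (`Thm33G0L2P.l0`, derived from rows
18's Theorem 3.10), G₀ symmetric, Δ_a = `𝔬.S0 U` positive definite (Theorem 3.11 for Δ_a — the schema's own first field, an INPUT here),
G₀Δ_a = I (`IdentitiesDef.invG0'`), and [4] Lemma 2.1 (2.61) as the row sum at a rate σ ≦ min(δ₁, δ₁′): `abs_form_le_of_stepBlockBd`
composed with `weightedL2_le_form_of_l0`.  With θ = θ₂·Mα₀ this is print's r = O(1)·Mα₀ (*"a small perturbation of Δ_a"*, p. 420).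
[cite: Balaban1985BackgroundPropagators, Thm 3.12 p.423 + Thm 3.11 p.416 + p.420 (after (3.126)) + (3.46) p.398 + (3.130)–(3.131) pp.421–422 + (3.137)–(3.138) p.423; Balaban1984PropagatorsII, Lemma 2.1 (2.61) p.234] -/
theorem formSmall_of_stepL2 (hG : GeoOK g) {𝔬 : Ops g B X Y Z W} {U : B.Cfg} {B₂ δ₁ θ δ₁' σ c r : ℝ}
    (hrow : RowSum (toB6 g R₀ H₀) σ c) (hc : 0 ≤ c) (hσ : σ ≤ δ₁) (hσ' : σ ≤ δ₁') (hB₂ : 0 ≤ B₂) (hθ : 0 ≤ θ)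
    (hr : θ * c * (B₂ * c) ≤ r)
    (hsym : IsTransposePair (𝔬.G0 U) (𝔬.G0 U)) (hpos : PosDefEnd (𝔬.S0 U)) (hinv : 𝔬.G0 U * 𝔬.S0 U = 1)
    (hl0 : BlockBd (g := toB6 g R₀ H₀) 𝔬.blk 𝔬.blk (𝔬.G0 U)
      (fun (y y' : g.Site) => B₂ * g.len y * g.len y' * Real.exp (-(δ₁ * g.dist y y'))))
    (hL2 : StepL2 𝔬 R₀ H₀ θ δ₁' U) : FormSmall 𝔬 r U := by
  have hW := weightedL2_le_form_of_l0 hG hrow hc hσ hB₂ hsym hpos hinv hl0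
  have hθc : 0 ≤ θ * c := mul_nonneg hθ hc
  have bound : ∀ {T : Module.End ℝ (X → ℝ)},
      BlockBd (g := toB6 g R₀ H₀) 𝔬.blk 𝔬.blk T
        (fun (y y' : g.Site) => θ * (g.len y)⁻¹ * (g.len y')⁻¹ * Real.exp (-(δ₁' * g.dist y y'))) →
      ∀ f : X → ℝ, |f ⬝ᵥ T f| ≤ r * (f ⬝ᵥ 𝔬.S0 U f) := by
    intro T hT f
    have hb : 0 ≤ f ⬝ᵥ 𝔬.S0 U f := hpos.nonneg f
    calc |f ⬝ᵥ T f| ≤ θ * c * ∑ y : g.Site, ((g.len y)⁻¹ * bl2 (g := toB6 g R₀ H₀) 𝔬.blk y f) ^ 2 :=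
          abs_form_le_of_stepBlockBd hG hrow hσ' hθ hT f
      _ ≤ θ * c * (B₂ * c * (f ⬝ᵥ 𝔬.S0 U f)) := mul_le_mul_of_nonneg_left (hW f) hθc
      _ = θ * c * (B₂ * c) * (f ⬝ᵥ 𝔬.S0 U f) := by ring
      _ ≤ r * (f ⬝ᵥ 𝔬.S0 U f) := mul_le_mul_of_nonneg_right hr hb
  exact ⟨hpos, bound hL2.t, bound hL2.t1⟩

end

end Literature.MathematicalPhysics.QuantumFieldTheory.Balaban1983to89.B9Thm312WholeFormSmallFromL2
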